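import Summits.ResolutionOfSingularities.ResolutionOfSingularities.Theorems.EquisingularLiftEquisingularLiftNatLargeCharRung
import Literature.AlgebraicGeometry.Motives.ProjectiveSpaceHypersurfaceCycle
import Literature.AlgebraicGeometry.Resolution.AlterationsSectionDivisor
import Literature.AlgebraicGeometry.Resolution.ProjectiveSpaceRegular
import Literature.AlgebraicGeometry.Motives.VarietiesProperProofs
import Literature.NumberTheory.Transcendental.RoySmallValueFactors
import Mathlib.RingTheory.Ideal.KrullsHeightTheorem
import Mathlib.RingTheory.UniqueFactorizationDomain.Ideal
import HarnessLib

/-!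
# EL♮ / EL♮(3) / EL — the crux hypothesis «closed, integral, ideal locally principal» SAYS «hypersurface»:
# `range ι = V₊(F)` for ONE prime form `F` (or `ι` is an isomorphism), and ★ RUNG LC in the crux's currency

leafhand-res-equisingularlift-5 g0 (prover, 2026-08-31; one-generation line-first hand on stmt-ResolutionOfSingularities-15660 / -20038 / -20148,
cell `pub/decomp-res`; item (r1) «crux-hypothesis packaging» of leafhand-4's repair census).  Crux `EquisingularLiftNatThree` (`stmt-…-20148`;
uniform in `n`, so also `EquisingularLiftNat` `stmt-…-20038` and the bookkeeping crux `EquisingularLift` `stmt-…-15660`), line W4.5(b), RUNG LC.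
DEF-FREE; no `sorry`; standard axioms; ZERO named hypotheses; `--supports stmt-…-20148 --as helper`, counted 0.

All three cruxes quantify over `H` with `ι : H ⟶ ℙⁿ_k` a CLOSED IMMERSION, `H` INTEGRAL and «`(ker ι)(U)` principal on an affine
neighbourhood `U` of every point» (`HypLocPrincipal`), whereas the landed RUNG LC ✓ `LargeChar.elnat_largeChar` (…NatLargeCharRung) is stated at
the cut «`H` integral ∧ `F ≠ 0` ∧ `range ι = V₊(F)`, `F` a form of degree `d`».  This file supplies the missing dictionary, in kernel:

* `coheight_le_one_of_isPrincipal_maximalIdeal` — on a locally Noetherian scheme a point whose local ring has PRINCIPAL maximal ideal has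
  codimension `≤ 1` (Krull's Hauptidealsatz, Mathlib `Ideal.height_le_one_of_isPrincipal_of_mem_minimalPrimes_of_isLocalRing`, and
  `dim 𝒪_{X,x} = coheight x`, Mathlib `ringKrullDim_stalk_eq_coheight`, Stacks 02IZ);
* `exists_prime_form_mem` — a non-zero homogeneous prime of `K[x₀, …, x_m]` contains a PRIME FORM (a homogeneous component, unique
  factorisation, divisors of forms are forms ✓ `Roy2013.isHomogeneous_of_dvd`);
* `toIdeal_ne_bot_of_coheight_ne_zero` — a point of `ℙᴺ` of positive codimension has non-zero homogeneous prime;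
* ★ `exists_eq_hypersurfacePoint_of_coheight_eq_one` — **prime divisors of `ℙ^{d+1}_K` are hypersurfaces**: a codimension-one point IS
  `ProjSpace.hypersurfacePoint F` for a prime form `F` (the converse of ✓ `ProjSpace.coheight_hypersurfacePoint`; Hartshorne II 6.4:
  height-one primes of the factorial `K[x]` are principal — here via specialisation `η_F ⤳ ξ` of two codimension-one points);
* `ker_stalkMap_genericPoint_eq_maximalIdeal` — for a closed immersion `ι : H ↪ X` with `H` integral, `ker (ι♯ at η_H) = 𝔪_{X, ι(η_H)}`;
* ★★ `isIso_or_exists_prime_form_range_eq` (`…_of_hyp` with the crux's verbatim hypothesis) — **THE DICTIONARY**: `ι : H ↪ ℙⁿ_k` a closed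
  immersion, `H` integral, `ker ι` locally principal at `ι(η_H)` ⟹ EITHER `ι` is an isomorphism OR `range ι = V₊(F)` and `𝔭_{ι(η_H)} = (F)` for a
  PRIME FORM `F` of degree `≥ 1` (`(ker ι)_{ι(η_H)} = 𝔪` ✓ `stalkIdeal_ker_eq_ker_stalkMap` is principal ⟹ `codim ι(η_H) ≤ 1`; `0` ⟹ `range ι = ℙⁿ`
  and Mathlib `isIso_of_isClosedImmersion_of_surjective`; `1` ⟹ hypersurface point; `ℙ⁰` has no codimension-one point ✓ `not_mem_asHomogeneousIdeal_of_fin_one`);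
* `exists_point_not_mem` — a non-zero form misses the point of `ℙⁿ` with zero ideal;
* ★ `elnat_largeChar_of_hyp` — **RUNG LC IN THE CRUX'S CURRENCY**: for all `n, D` there is `M(n, D)` such that for every prime `p > M`, every
  algebraically closed `k` of characteristic `p` and every `(H, ι)` satisfying the crux hypotheses and lying on SOME hypersurface of degree `≤ D`,
  `ELNatConclusionO k n H ι` (the dictionary puts `range ι = V₊(F)` with `F` prime, `G ∈ 𝔭_{ι(η_H)} = (F)` bounds `deg F ≤ D`, and
  ✓ `elnat_largeChar n (deg F)` applies with `M(n, D) = max_{d ≤ D} M(n, d)`).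

HONEST READING: `elnat_largeChar_of_hyp` is a RUNG (M ineffective and dependent on the degree bound `D`) — NOT EL♮(3), NOT EL♮, NOT `EquisingularLift`
(which quantify over ALL `H` at a fixed `p`), and it closes none of the registered stubs (`stub_elnat_three_isolated_nonNDLeaves9`,
`stub_elnat_three_nonisolated_…Desc`, `stub_elnat_ge_four_reachExit`, `stub_CJS2020Sequence`, `stub_CP2019General`, `stub_blowupModel_ge_five`).
Resolution of singularities in positive characteristic is NOT proved; nothing of [Hironaka2017] (a candidate under adjudication) is asserted or used.
AI-written; AI review is weaker than expert review.
[cite: Hartshorne1977, II Prop. 2.5, Prop. 6.4, Ex. 6.5] [cite: StacksProject, Tag 02IZ] [cite: Grothendieck1966, EGA IV₃ §8–§9] (method; index only)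
-/

set_option linter.dupNamespace false -- mandated namespace `Summit.<Summit>.<Problem>` of this single-conjunct summit

noncomputable section

open CategoryTheory CategoryTheory.Limits AlgebraicGeometry TopologicalSpace Topology Order IsLocalRing
open MvPolynomial
open Literature.AlgebraicGeometry.Resolution
open Literature.AlgebraicGeometry.Motives
open AlgebraicGeometry.Scheme.IdealSheafData

universe u

namespace Summit.ResolutionOfSingularities.ResolutionOfSingularities.Cruxes.EquisingularLiftNat.Sections

namespace LargeChar

/-! ## A point whose local ring has principal maximal ideal has codimension `≤ 1` -/

/-- **Krull's principal ideal theorem at a point**: on a locally Noetherian scheme, a point `x` whose local ring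
`𝒪_{X,x}` has PRINCIPAL maximal ideal has codimension `coheight x ≤ 1` (`dim 𝒪_{X,x} = ht 𝔪_x ≤ 1` by Krull's
Hauptidealsatz, and `dim 𝒪_{X,x} = coheight x`, Stacks 02IZ). [cite: StacksProject, Tag 02IZ] [folklore] -/
theorem coheight_le_one_of_isPrincipal_maximalIdeal {X : Scheme.{u}} [IsLocallyNoetherian X] (x : X)
    (h : (maximalIdeal (X.presheaf.stalk x)).IsPrincipal) : coheight x ≤ 1 := by
  haveI := h
  have h1 : (maximalIdeal (X.presheaf.stalk x)).height ≤ 1 :=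
    Ideal.height_le_one_of_isPrincipal_of_mem_minimalPrimes_of_isLocalRing (maximalIdeal _)
      (by rw [Ideal.minimalPrimes_eq_subsingleton_self]; rfl)
  have h2 : ((coheight x : ℕ∞) : WithBot ℕ∞) ≤ ((1 : ℕ∞) : WithBot ℕ∞) := by
    rw [← ringKrullDim_stalk_eq_coheight x, ← IsLocalRing.maximalIdeal_height_eq_ringKrullDim]
    exact_mod_cast h1
  exact_mod_cast h2

/-! ## A non-zero homogeneous prime of `K[x₀, …, x_m]` contains a prime FORM -/

/-- **A non-zero homogeneous prime ideal of the polynomial ring over a field contains a prime form**: a non-zero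
element has a non-zero homogeneous component in the ideal (homogeneity), which is a non-unit and factors into primes
(`K[x]` is factorial), one of which lies in the prime ideal; divisors of non-zero forms are forms. [folklore] -/
theorem exists_prime_form_mem {m : ℕ} {K : Type u} [Field K] :
    letI := MvPolynomial.gradedAlgebra (σ := Fin m) (R := K)
    ∀ (I : HomogeneousIdeal (MvPolynomial.homogeneousSubmodule (Fin m) K)), I.toIdeal.IsPrime → I.toIdeal ≠ ⊥ →
      ∃ (e : ℕ) (F : MvPolynomial (Fin m) K),
        F ∈ MvPolynomial.homogeneousSubmodule (Fin m) K e ∧ Prime F ∧ F ∈ I := by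
  classical
  letI := MvPolynomial.gradedAlgebra (σ := Fin m) (R := K)
  intro I _ hI
  -- a non-zero homogeneous element of `I`
  obtain ⟨G, hGI, hG0⟩ := Submodule.exists_mem_ne_zero_of_ne_bot hI
  have hcomp : ∃ i : ℕ,
      (DirectSum.decompose (MvPolynomial.homogeneousSubmodule (Fin m) K) G i : MvPolynomial (Fin m) K) ≠ 0 := by
    by_contra h
    push Not at h
    apply hG0
    rw [← DirectSum.sum_support_decompose (MvPolynomial.homogeneousSubmodule (Fin m) K) G]
    exact Finset.sum_eq_zero fun i _ => h i
  obtain ⟨i, hi⟩ := hcomp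
  set Gi : MvPolynomial (Fin m) K :=
    (DirectSum.decompose (MvPolynomial.homogeneousSubmodule (Fin m) K) G i : MvPolynomial (Fin m) K) with hGi
  have hGiI : Gi ∈ I.toIdeal := (Ideal.IsHomogeneous.mem_iff _ I.isHomogeneous).1 hGI i
  have hGihom : Gi.IsHomogeneous i :=
    (MvPolynomial.mem_homogeneousSubmodule i Gi).1 (SetLike.coe_mem _)
  -- a prime factor of `Gi` inside `I`
  obtain ⟨u, hu⟩ := UniqueFactorizationMonoid.factors_prod hi
  have hprodI : (UniqueFactorizationMonoid.factors Gi).prod ∈ I.toIdeal := by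
    rw [← hu, Ideal.mul_unit_mem_iff_mem _ u.isUnit] at hGiI
    exact hGiI
  obtain ⟨p, hp1, hp2⟩ :=
    ((inferInstance : I.toIdeal.IsPrime).multiset_prod_mem_iff_exists_mem (UniqueFactorizationMonoid.factors Gi)).1 hprodI
  refine ⟨p.totalDegree, p, (MvPolynomial.mem_homogeneousSubmodule _ _).2 ?_,
    UniqueFactorizationMonoid.prime_of_factor p hp1, hp2⟩
  exact Literature.NumberTheory.Transcendental.Roy2013.isHomogeneous_of_dvd hGihom hi
    (UniqueFactorizationMonoid.dvd_of_mem_factors hp1)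

/-! ## Codimension-one points of `ℙ^{d+1}_K` are hypersurface points -/

/-- **Prime divisors of projective space are hypersurfaces**: a point `ξ` of `ℙ^{d+1}_K` of codimension ONE
(`coheight ξ = 1`) is the generic point `η_F` of the hypersurface `V₊(F)` of a prime form `F` (its homogeneous prime is
non-zero — else `ξ` is the generic point, of codimension `0` — so contains a prime form `F`; then `η_F ⤳ ξ` with both of
codimension one, hence `η_F = ξ`). The converse of `ProjSpace.coheight_hypersurfacePoint`. (Hartshorne II Prop. 6.4's
proof: height-one homogeneous primes of `K[x₀,…,xₙ]` are principal.) [cite: Hartshorne1977, II Prop. 2.5 and Prop. 6.4] -/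
theorem exists_eq_hypersurfacePoint_of_coheight_eq_one {d : ℕ} {K : Type u} [Field K]
    (ξ : ↥(projectiveSpace (d + 1) K).left) (hξ : coheight ξ = 1) :
    ∃ (e : ℕ) (F : MvPolynomial (Fin (d + 1 + 1)) K) (hF : F ∈ Segre.grading (Fin (d + 1 + 1)) K e)
      (hp : Prime F), ξ = ProjSpace.hypersurfacePoint F hF hp := by
  letI := MvPolynomial.gradedAlgebra (σ := Fin (d + 1 + 1)) (R := K)
  -- the homogeneous prime of `ξ` is non-zero
  have hne : (ξ.asHomogeneousIdeal).toIdeal ≠ ⊥ := by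
    intro h
    have hcl : closure ({ξ} : Set ↥(projectiveSpace (d + 1) K).left) = Set.univ := by
      rw [closure_singleton_eq_zeroLocus (N := d + 1) (k := K)]
      change ProjectiveSpectrum.zeroLocus _ ((ξ.asHomogeneousIdeal).toIdeal :
        Set (MvPolynomial (Fin (d + 1 + 1)) K)) = _
      rw [h]
      exact ProjectiveSpectrum.zeroLocus_bot _
    have hgen : IsGenericPoint ξ (⊤ : Set ↥(projectiveSpace (d + 1) K).left) := by
      rw [isGenericPoint_def, hcl]; rfl
    have hξtop : ξ = ⊤ := hgen.eq (genericPoint_spec ↥(projectiveSpace (d + 1) K).left)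
    have h0 : coheight ξ = 0 := by
      rw [hξtop]
      exact coheight_eq_zero.mpr isMax_top
    rw [h0] at hξ
    exact zero_ne_one hξ
  haveI : (ξ.asHomogeneousIdeal).toIdeal.IsPrime := ξ.isPrime
  obtain ⟨e, F, hF, hprime, hFξ⟩ := exists_prime_form_mem ξ.asHomogeneousIdeal ξ.isPrime hne
  refine ⟨e, F, hF, hprime, ?_⟩
  set η := ProjSpace.hypersurfacePoint F hF hprime with hη
  have hηξ : η ⤳ ξ := by
    refine (ProjSpace.specializes_iff_le (d := d + 1) (K := K) (a := η) (b := ξ)).2 ?_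
    rw [hη, ProjSpace.toIdeal_hypersurfacePoint, Ideal.span_singleton_le_iff_mem]
    exact hFξ
  have hle : ξ ≤ η := Scheme.le_iff_specializes.mpr hηξ
  by_contra hne'
  have hlt : ξ < η := lt_of_le_not_ge hle fun hge =>
    hne' (hηξ.antisymm (Scheme.le_iff_specializes.mp hge)).eq.symm
  have h1 := coheight_add_one_le hlt
  rw [hη, ProjSpace.coheight_hypersurfacePoint, hξ] at h1
  exact absurd h1 (by decide)

/-! ## The homogeneous prime of a non-generic point of `ℙᴺ` is non-zero -/

/-- A point of `ℙᴺ_K` of POSITIVE codimension has a non-zero homogeneous prime (the point with zero ideal is the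
generic point, of codimension `0`). [folklore] -/
theorem toIdeal_ne_bot_of_coheight_ne_zero {N : ℕ} {K : Type u} [Field K]
    (ξ : ↥(projectiveSpace N K).left) (hξ : coheight ξ ≠ 0) :
    letI := MvPolynomial.gradedAlgebra (σ := Fin (N + 1)) (R := K)
    (ξ.asHomogeneousIdeal).toIdeal ≠ ⊥ := by
  letI := MvPolynomial.gradedAlgebra (σ := Fin (N + 1)) (R := K)
  haveI : IsIntegral (projectiveSpace N K).left := isIntegral_projectiveSpace N K
  intro h
  have hcl : closure ({ξ} : Set ↥(projectiveSpace N K).left) = Set.univ := by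
    rw [closure_singleton_eq_zeroLocus (N := N) (k := K)]
    change ProjectiveSpectrum.zeroLocus _ ((ξ.asHomogeneousIdeal).toIdeal :
      Set (MvPolynomial (Fin (N + 1)) K)) = _
    rw [h]
    exact ProjectiveSpectrum.zeroLocus_bot _
  have hgen : IsGenericPoint ξ (⊤ : Set ↥(projectiveSpace N K).left) := by
    rw [isGenericPoint_def, hcl]; rfl
  have hξtop : ξ = ⊤ := hgen.eq (genericPoint_spec ↥(projectiveSpace N K).left)
  apply hξ
  rw [hξtop]
  exact coheight_eq_zero.mpr isMax_top

/-! ## The crux hypothesis «integral, closed, ideal locally principal» says «hypersurface» -/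

/-- **The kernel of the stalk map of a closed immersion `ι : H ↪ X` from an INTEGRAL scheme at its generic point is the
maximal ideal of `𝒪_{X, ι(η_H)}`** (the map is surjective onto the function field of `H`). [folklore] -/
theorem ker_stalkMap_genericPoint_eq_maximalIdeal {X H : Scheme.{u}} (ι : H ⟶ X) [IsClosedImmersion ι] [IsIntegral H] :
    RingHom.ker (ι.stalkMap (genericPoint H)).hom = maximalIdeal (X.presheaf.stalk (ι (genericPoint H))) := by
  have hF : IsField (H.presheaf.stalk (genericPoint H)) :=
    isField_stalk_of_closure_mem_irreducibleComponents H (genericPoint H)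
      (by simp [irreducibleComponents_eq_singleton])
  letI := hF.toField
  exact IsLocalRing.eq_maximalIdeal
    (RingHom.ker_isMaximal_of_surjective (ι.stalkMap (genericPoint H)).hom (ι.stalkMap_surjective (genericPoint H)))

/-- **The crux hypothesis says «hypersurface».** Let `k` be a field, `H` an INTEGRAL scheme and `ι : H ↪ ℙⁿ_k` a closed
immersion whose ideal `ker ι` is locally principal AT the generic point `ι(η_H)` (e.g. the crux hypothesis «`(ker ι)(U)` principal
on an affine neighbourhood of every point»).  Then EITHER `ι` is an isomorphism (`H = ℙⁿ`) OR there is a PRIME FORM `F` of degree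
`e ≥ 1` with `range ι = V₊(F)` — `H` is the integral hypersurface `{F = 0}`.  Proof: `ker ι` generates the maximal ideal of
`𝒪_{ℙⁿ, ι(η_H)}` (the stalk map is onto the function field of `H`), which is therefore principal, so `codim ι(η_H) ≤ 1` (Krull);
codimension `0` means `range ι = ℙⁿ` (and a surjective closed immersion into a reduced scheme is an isomorphism), codimension `1`
means `ι(η_H)` is the generic point of the hypersurface of a prime form (`exists_eq_hypersurfacePoint_of_coheight_eq_one`).
[cite: Hartshorne1977, II Prop. 6.4 and Ex. 6.5] [OURS · L1 W4.5b · crux-hypothesis packaging (leafhand-4 census (r1)); DEF-FREE] -/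
theorem isIso_or_exists_prime_form_range_eq {k : Type} [Field k] {n : ℕ} {H : Scheme.{0}}
    (ι : H ⟶ (projectiveSpace n k).left) [IsClosedImmersion ι] [IsIntegral H]
    (hpr : IsLocallyPrincipalAt ι.ker (ι (genericPoint H))) :
    IsIso ι ∨ ∃ (e : ℕ) (F : MvPolynomial (Fin (n + 1)) k), 0 < e ∧ F.IsHomogeneous e ∧ Prime F ∧
      letI := MvPolynomial.gradedAlgebra (σ := Fin (n + 1)) (R := k)
      ((ι (genericPoint H)).asHomogeneousIdeal).toIdeal = Ideal.span {F} ∧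
      Set.range ι = {x : Proj (homogeneousSubmodule (Fin (n + 1)) k) | F ∈ x.asHomogeneousIdeal} := by
  classical
  letI := MvPolynomial.gradedAlgebra (σ := Fin (n + 1)) (R := k)
  haveI : IsIntegral (projectiveSpace n k).left := isIntegral_projectiveSpace n k
  haveI : IsLocallyNoetherian (projectiveSpace n k).left := by
    haveI := isProper_projectiveSpace n k
    exact LocallyOfFiniteType.isLocallyNoetherian (projectiveSpace n k).hom
  set ξ : ↥(projectiveSpace n k).left := ι (genericPoint H) with hξdef
  -- `range ι = closure {ξ}`
  have hrange : Set.range ι = closure {ξ} := by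
    have h := (genericPoint_spec H).image ι.continuous
    rw [Set.image_univ, ι.isClosedEmbedding.isClosed_range.closure_eq] at h
    exact h.symm
  -- the maximal ideal of `𝒪_{ℙ, ξ}` is principal
  have hmax : (maximalIdeal ((projectiveSpace n k).left.presheaf.stalk ξ)).IsPrincipal := by
    obtain ⟨U, hξU, g, hg⟩ := hpr
    have h1 : stalkIdeal ι.ker ξ =
        Ideal.span {((projectiveSpace n k).left.presheaf.germ U ξ hξU).hom g} := by
      rw [stalkIdeal_eq_map_germ ι.ker U hξU, hg, Ideal.map_span, Set.image_singleton]
    rw [← ker_stalkMap_genericPoint_eq_maximalIdeal ι, ← stalkIdeal_ker_eq_ker_stalkMap ι (genericPoint H), h1]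
    exact ⟨_, rfl⟩
  have hcoh : coheight ξ ≤ 1 := coheight_le_one_of_isPrincipal_maximalIdeal ξ hmax
  rcases eq_or_lt_of_le hcoh with h1 | h0
  · -- codimension one: `ξ` is a hypersurface point
    right
    cases n with
    | zero =>
      -- `ℙ⁰` has no point of positive codimension
      exfalso
      have hne := toIdeal_ne_bot_of_coheight_ne_zero ξ (by rw [h1]; exact one_ne_zero)
      haveI : (ξ.asHomogeneousIdeal).toIdeal.IsPrime := ξ.isPrime
      obtain ⟨e, F, hF, hprime, hFξ⟩ := exists_prime_form_mem ξ.asHomogeneousIdeal ξ.isPrime hne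
      exact not_mem_asHomogeneousIdeal_of_fin_one k F ((mem_homogeneousSubmodule e F).1 hF) hprime.ne_zero ξ hFξ
    | succ d =>
      obtain ⟨e, F, hF, hprime, hξF⟩ := exists_eq_hypersurfacePoint_of_coheight_eq_one ξ h1
      refine ⟨e, F, ProjSpace.pos_of_mem_grading_of_prime hF hprime, (mem_homogeneousSubmodule e F).1 hF, hprime,
        ?_, ?_⟩
      · have hI := ProjSpace.toIdeal_hypersurfacePoint F hF hprime
        rw [← hξF] at hI
        exact hI
      · rw [hrange, hξF, ProjSpace.closure_hypersurfacePoint]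
        ext x
        rw [ProjectiveSpectrum.mem_zeroLocus, Set.singleton_subset_iff]
        rfl
  · -- codimension zero: `ξ` is the generic point of `ℙⁿ`, `ι` is surjective, hence an isomorphism
    left
    have h0' : coheight ξ = 0 := Order.lt_one_iff.mp h0
    have hmaxpt : IsMax ξ := coheight_eq_zero.mp h0'
    have hspec : ξ ⤳ (⊤ : ↥(projectiveSpace n k).left) := Scheme.le_iff_specializes.mp (hmaxpt le_top)
    have htop : closure ({(⊤ : ↥(projectiveSpace n k).left)} : Set ↥(projectiveSpace n k).left) = Set.univ :=
      (genericPoint_spec ↥(projectiveSpace n k).left)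
    have huniv : Set.range ι = Set.univ := by
      rw [hrange]
      apply Set.eq_univ_of_univ_subset
      rw [← htop]
      exact closure_minimal (Set.singleton_subset_iff.2 (specializes_iff_mem_closure.mp hspec)) isClosed_closure
    haveI : Surjective ι := ⟨Set.range_eq_univ.mp huniv⟩
    exact isIso_of_isClosedImmersion_of_surjective ι

/-- **The same, from the crux's VERBATIM hypothesis** «`(ker ι)(U)` is principal on some affine open neighbourhood `U` of every
point of `ℙⁿ_k`» (`HypLocPrincipal`), of which only the instance at the generic point of `range ι` is used. [OURS · DEF-FREE] -/
theorem isIso_or_exists_prime_form_range_eq_of_hyp {k : Type} [Field k] {n : ℕ} {H : Scheme.{0}}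
    (ι : H ⟶ (projectiveSpace n k).left) [IsClosedImmersion ι] [IsIntegral H]
    (hpr : ∀ y : (projectiveSpace n k).left, ∃ U : (projectiveSpace n k).left.affineOpens,
      y ∈ (U : (projectiveSpace n k).left.Opens) ∧ (ι.ker.ideal U).IsPrincipal) :
    IsIso ι ∨ ∃ (e : ℕ) (F : MvPolynomial (Fin (n + 1)) k), 0 < e ∧ F.IsHomogeneous e ∧ Prime F ∧
      letI := MvPolynomial.gradedAlgebra (σ := Fin (n + 1)) (R := k)
      ((ι (genericPoint H)).asHomogeneousIdeal).toIdeal = Ideal.span {F} ∧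
      Set.range ι = {x : Proj (homogeneousSubmodule (Fin (n + 1)) k) | F ∈ x.asHomogeneousIdeal} := by
  obtain ⟨U, hU, ⟨g, hg⟩⟩ := hpr (ι (genericPoint H))
  exact isIso_or_exists_prime_form_range_eq ι ⟨U, hU, g, hg⟩

/-! ## RUNG LC in the crux's currency -/

/-- The point of `ℙⁿ_k` with ZERO homogeneous ideal (the generic point); a non-zero form lies outside it. [folklore] -/
theorem exists_point_not_mem {k : Type u} [Field k] {n : ℕ} (G : MvPolynomial (Fin (n + 1)) k) (hG : G ≠ 0) :
    letI := MvPolynomial.gradedAlgebra (σ := Fin (n + 1)) (R := k)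
    ∃ y : Proj (homogeneousSubmodule (Fin (n + 1)) k), G ∉ y.asHomogeneousIdeal := by
  letI := MvPolynomial.gradedAlgebra (σ := Fin (n + 1)) (R := k)
  let y₀ : Proj (homogeneousSubmodule (Fin (n + 1)) k) :=
    (⟨⊥, by rw [HomogeneousIdeal.toIdeal_bot]; exact Ideal.isPrime_bot, fun h => by
      have hX : (X 0 : MvPolynomial (Fin (n + 1)) k) ∈
          HomogeneousIdeal.irrelevant (MvPolynomial.homogeneousSubmodule (Fin (n + 1)) k) :=
        HomogeneousIdeal.mem_irrelevant_of_mem _ zero_lt_one (X_mem_homogeneousSubmodule_one 0)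
      have h0 := h hX
      rw [← HomogeneousIdeal.mem_iff, HomogeneousIdeal.toIdeal_bot, Ideal.mem_bot] at h0
      exact MvPolynomial.X_ne_zero _ h0⟩ :
      ProjectiveSpectrum (MvPolynomial.homogeneousSubmodule (Fin (n + 1)) k))
  refine ⟨y₀, fun h => hG ?_⟩
  have h0 : G ∈ ((⊥ : HomogeneousIdeal (MvPolynomial.homogeneousSubmodule (Fin (n + 1)) k)).toIdeal) := h
  rwa [HomogeneousIdeal.toIdeal_bot, Ideal.mem_bot] at h0

/-- ★ **RUNG LC in the crux's currency.**  For every `n, D : ℕ` there is `M = M(n, D)` such that: for every prime `p > M`, every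
algebraically closed field `k` of characteristic `p`, and every `H` with `ι : H ↪ ℙⁿ_k` satisfying the HYPOTHESES OF THE CRUX
(`EquisingularLiftNat` / `EquisingularLiftNatThree` / `EquisingularLift`: `ι` a closed immersion, `H` integral, `ker ι` locally principal)
and lying on SOME hypersurface of degree `≤ D` (a non-zero form `G` of degree `e ≤ D` vanishing on `range ι` — a degree bound, the only
extra input), the conclusion `ELNatConclusionO k n H ι` of EL♮(n) holds.  Proof: by `isIso_or_exists_prime_form_range_eq_of_hyp`,
`range ι = V₊(F)` for a prime form `F` generating the prime of `ι(η_H)` (the isomorphism case is excluded: a non-zero form does not vanish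
at the generic point of `ℙⁿ`); `G ∈ 𝔭_{ι(η_H)} = (F)`, so `deg F ≤ deg G ≤ D`; apply ✓ `elnat_largeChar n (deg F)` with
`M(n, D) := max_{d ≤ D} M(n, d)`.  HONEST: a RUNG (M ineffective, depends on the degree bound `D`); NOT EL♮(3) / EL♮ / EL (all degrees at a
fixed `p`); closes no registered stub; resolution in positive characteristic NOT proved. [OURS · L1 W4.5b · RUNG LC in crux currency
(leafhand-4 census (r1)); DEF-FREE; ZERO named hypotheses] [cite: Grothendieck1966, EGA IV₃ §8–§9] (method; index only) -/
theorem elnat_largeChar_of_hyp (n D : ℕ) :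
    ∃ M : ℕ, ∀ (p : ℕ), p.Prime → ∀ (k : Type) [Field k] [CharP k p] [IsAlgClosed k], M < p →
      ∀ (H : Scheme.{0}) (ι : H ⟶ (Literature.AlgebraicGeometry.Motives.projectiveSpace n k).left),
        IsClosedImmersion ι → IsIntegral H →
        (∀ y : (Literature.AlgebraicGeometry.Motives.projectiveSpace n k).left,
          ∃ U : (Literature.AlgebraicGeometry.Motives.projectiveSpace n k).left.affineOpens,
            y ∈ (U : (Literature.AlgebraicGeometry.Motives.projectiveSpace n k).left.Opens) ∧ (ι.ker.ideal U).IsPrincipal) →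
        (∃ (e : ℕ) (G : MvPolynomial (Fin (n + 1)) k), e ≤ D ∧ G.IsHomogeneous e ∧ G ≠ 0 ∧
          letI := MvPolynomial.gradedAlgebra (σ := Fin (n + 1)) (R := k)
          Set.range ι ⊆ {x : Proj (homogeneousSubmodule (Fin (n + 1)) k) | G ∈ x.asHomogeneousIdeal}) →
        ELNatConclusionO k n H ι := by
  classical
  choose M hM using fun d => elnat_largeChar n d
  refine ⟨(Finset.range (D + 1)).sup M, fun p hp k _ _ _ hMp H ι hι hH hpr hdeg => ?_⟩
  letI := MvPolynomial.gradedAlgebra (σ := Fin (n + 1)) (R := k)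
  obtain ⟨e, G, heD, hG, hG0, hsub⟩ := hdeg
  haveI := hι
  haveI := hH
  rcases isIso_or_exists_prime_form_range_eq_of_hyp ι hpr with hiso | ⟨e', F, -, hF, hprime, hgen, hrange⟩
  · -- `ι` an isomorphism: `G` would vanish at every point of `ℙⁿ`, so `G = 0`
    exfalso
    obtain ⟨y, hy⟩ := exists_point_not_mem G hG0
    haveI : IsIso ι := hiso
    obtain ⟨x, hx⟩ := ι.surjective y
    exact hy (hx ▸ hsub ⟨x, rfl⟩)
  · -- `range ι = V₊(F)`, `G ∈ (F)`, `deg F ≤ deg G ≤ D`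
    have hGξ : G ∈ ((ι (genericPoint H)).asHomogeneousIdeal).toIdeal :=
      HomogeneousIdeal.mem_iff.2 (hsub ⟨genericPoint H, rfl⟩)
    have hGF : G ∈ Ideal.span {F} := hgen ▸ hGξ
    obtain ⟨Q, hQ⟩ := Ideal.mem_span_singleton'.mp hGF
    have hdegF : e' ≤ e := by
      have h1 : F.totalDegree = e' := hF.totalDegree hprime.ne_zero
      have h2 : G.totalDegree = e := hG.totalDegree hG0
      have hQ0 : Q ≠ 0 := by rintro rfl; exact hG0 (by rw [← hQ, zero_mul])
      have h3 : (Q * F).totalDegree = Q.totalDegree + F.totalDegree :=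
        MvPolynomial.totalDegree_mul_of_isDomain hQ0 hprime.ne_zero
      rw [hQ] at h3
      omega
    have hMe : M e' < p := lt_of_le_of_lt
      (Finset.le_sup (f := M) (Finset.mem_range.2 (by omega))) hMp
    exact hM e' p hp k hMe H ι F hF ⟨hH, hprime.ne_zero, hrange⟩

end LargeChar

end Summit.ResolutionOfSingularities.ResolutionOfSingularities.Cruxes.EquisingularLiftNat.Sections

end
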